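import Summits.FinalStateConjecture.FinalStateConjecture.Theorems.EIHFluxBalanceInertialRecessionBoostedDecay
import Summits.FinalStateConjecture.FinalStateConjecture.Theorems.EIHFluxBalanceInertialRecessionLorentz
import Literature.Geometry.Lorentzian.KerrEnergyIdentity

/-!
# Route EIHFluxBalance — `InertialRecession`: decay of one summand of the modulated ansatz on a lab slab

Helper file for the crux `stmt-FinalStateConjecture-10166`
(`Summit.FinalStateConjecture.FinalStateConjecture.Theses.EIHFluxBalance.InertialRecession`).

Specialisation of the generic frame-decay estimate
(`exists_norm_iteratedFDeriv_ksPert_frame_le`, file `…BoostedDecay`) to the LITERAL summand of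
the crux's reference field,
`y ↦ boostedKerrBilin (Λ (y⁰)) (E4.ofTimeSpace (y⁰) (ξ (y⁰))) M a y − η`,
evaluated on the lab slab `{x⁰ = t}` at lab distance `d = ‖x̲ − ξ(t)‖` from the painted centre:

  `‖Dᵐ(summand)(x)‖ ≤ |M|·C(m, Γ) / ‖x̲ − ξ(t)‖`   (`exists_norm_iteratedFDeriv_ansatzSummand_le`)

for `‖x̲ − ξ(t)‖ ≥ max 1 (2|a|)`, given pointwise bounds `Γ` on `m` derivatives of the frame path
`s ↦ Λ(s)⁻¹` and of the centre path `ξ` at `s = t`. The two inputs beyond the generic estimate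
are (i) the identity `boostedKerrBilin Λ c M a y − η = (g_{M,a} − η)(Λ⁻¹(y − c))(Λ⁻¹·, Λ⁻¹·)`
(`boostedKerrBilin_sub_minkowski_apply`, Lorentz invariance of `η`), and (ii) BOOSTS STRETCH
spatial vectors (`norm_le_spatialNorm_lorentz_apply`, file `…Lorentz`), so the painted rest-frame
radius of a slab point dominates its lab distance to the centre whatever the boost. Also the
bookkeeping `‖(s ↦ (s, ξ(s)))⁽ᵏ⁾‖ ≤ 1 + ‖ξ⁽ᵏ⁾‖` (`norm_iteratedDeriv_centre_le`).
-/

noncomputable section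

open Literature.Geometry.Lorentzian Set Filter Function
open scoped ContDiff Topology

namespace Summit.FinalStateConjecture.FinalStateConjecture.Theorems

/-- A continuous linear map `ℝ → F`, `s ↦ s • v`, has `‖Dᵏ‖ ≤ ‖v‖` for `k ≥ 1` (`D¹ = v`,
`Dᵏ = 0` for `k ≥ 2`). [folklore] -/
theorem norm_iteratedFDeriv_smul_const_le {F : Type*} [NormedAddCommGroup F] [NormedSpace ℝ F]
    (v : F) (t : ℝ) {k : ℕ} (hk : 1 ≤ k) :
    ‖iteratedFDeriv ℝ k (fun s : ℝ ↦ s • v) t‖ ≤ ‖v‖ := by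
  obtain ⟨j, rfl⟩ := Nat.exists_eq_add_of_le' hk
  rw [← norm_iteratedFDeriv_fderiv]
  have hfd : (fderiv ℝ fun s : ℝ ↦ s • v) = fun _ ↦ (1 : ℝ →L[ℝ] ℝ).smulRight v := by
    funext s
    exact ((hasFDerivAt_id s).smul_const v).fderiv
  rw [hfd]
  rcases Nat.eq_zero_or_pos j with hj | hj
  · subst hj
    rw [norm_iteratedFDeriv_zero, ContinuousLinearMap.norm_smulRight_apply, norm_one, one_mul]
  · rw [iteratedFDeriv_const_of_ne (Nat.pos_iff_ne_zero.mp hj)]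
    simp

/-- **Derivatives of the centre path in spacetime**: for `ξ : ℝ → E3` and `k ≥ 1`,
`‖(s ↦ (s, ξ(s)))⁽ᵏ⁾(t)‖ ≤ 1 + ‖ξ⁽ᵏ⁾(t)‖` (`(s, ξ(s)) = s ∂₀ + (0, ξ(s))`, and `y ↦ (0, y)` is
a norm-preserving linear map). [folklore] -/
theorem norm_iteratedDeriv_centre_le {ξ : ℝ → E3} {n : WithTop ℕ∞} (hξ : ContDiff ℝ n ξ) (t : ℝ)
    {k : ℕ} (hk : 1 ≤ k) (hkn : (k : WithTop ℕ∞) ≤ n) :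
    ‖iteratedDeriv k (fun s ↦ E4.ofTimeSpace s (ξ s)) t‖ ≤ 1 + ‖iteratedDeriv k ξ t‖ := by
  rw [← norm_iteratedFDeriv_eq_norm_iteratedDeriv, ← norm_iteratedFDeriv_eq_norm_iteratedDeriv]
  have hsplit : (fun s ↦ E4.ofTimeSpace s (ξ s)) =
      (fun s : ℝ ↦ s • E4.basisVector 0) + fun s ↦ E4.spaceEmbed (ξ s) := by
    funext s
    exact E4.ofTimeSpace_eq_smul_add' s (ξ s)
  have h1 : ContDiff ℝ n (fun s : ℝ ↦ s • E4.basisVector 0) := contDiff_id.smul contDiff_const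
  have h2 : ContDiff ℝ n (fun s ↦ E4.spaceEmbed (ξ s)) := E4.spaceEmbed.contDiff.comp hξ
  rw [hsplit, iteratedFDeriv_add_apply (h1.of_le hkn).contDiffAt (h2.of_le hkn).contDiffAt]
  refine (norm_add_le _ _).trans (add_le_add ?_ ?_)
  · refine (norm_iteratedFDeriv_smul_const_le (E4.basisVector 0) t hk).trans ?_
    rw [show ‖E4.basisVector 0‖ = 1 by simp]
  · have h3 := E4.spaceEmbed.norm_iteratedFDeriv_comp_left (f := ξ) (x := t) (n := k)
      (hξ.contDiffAt) hkn
    refine h3.trans ?_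
    have h4 : ‖E4.spaceEmbed‖ ≤ 1 := by
      refine ContinuousLinearMap.opNorm_le_bound _ zero_le_one fun y ↦ ?_
      rw [one_mul, E4.spaceEmbed_apply,
        norm_eq_spatialNorm_of_apply_zero_eq_zero (E4.ofTimeSpace_apply_zero 0 y),
        E4.spatialNorm_ofTimeSpace]
    calc ‖E4.spaceEmbed‖ * ‖iteratedFDeriv ℝ k ξ t‖ ≤ 1 * ‖iteratedFDeriv ℝ k ξ t‖ :=
          mul_le_mul_of_nonneg_right h4 (norm_nonneg _)
      _ = ‖iteratedFDeriv ℝ k ξ t‖ := one_mul _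

/-- The crux's ansatz summand IS the frame-composed Kerr–Schild perturbation with frame path
`s ↦ Λ(s)⁻¹` and centre path `s ↦ (s, ξ(s))` (`boostedKerrBilin_sub_minkowski_apply`: Lorentz
invariance of `η`). [cite: KerrSchild1965, §2] -/
theorem boostedKerrBilin_sub_eq_bilinearComp (Λ : ℝ → lorentzGroup) (ξ : ℝ → E3) (M a : ℝ) :
    (fun y : E4 ↦ boostedKerrBilin (Λ (y 0)) (E4.ofTimeSpace (y 0) (ξ (y 0))) M a y -
      Minkowski.bilin) =
    fun y ↦ (Kerr.bilin M a ((((Λ (y 0) : E4 ≃L[ℝ] E4).symm : E4 →L[ℝ] E4))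
      (y - E4.ofTimeSpace (y 0) (ξ (y 0)))) - Minkowski.bilin).bilinearComp
      (((Λ (y 0) : E4 ≃L[ℝ] E4).symm : E4 →L[ℝ] E4))
      (((Λ (y 0) : E4 ≃L[ℝ] E4).symm : E4 →L[ℝ] E4)) := by
  funext y
  refine ContinuousLinearMap.ext fun v ↦ ContinuousLinearMap.ext fun w ↦ ?_
  rw [ContinuousLinearMap.bilinearComp_apply, boostedKerrBilin_sub_minkowski_apply]
  rfl

-- operator-norm instance paths on form-valued multilinear maps are slow to unify
set_option synthInstance.maxHeartbeats 200000 in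
/-- **`Cᵐ` decay of one summand of the modulated multi-Kerr–Schild ansatz on a lab slab.** For
every order `m` and size `Γ ≥ 1` there is `C ≥ 0` such that: for all `M, a`, all `Cᵐ` motions
`Λ : ℝ → O(1,3)` (through `s ↦ Λ(s)⁻¹` as operators) and `ξ : ℝ → E3` with
`‖(Λ⁻¹)⁽ᵏ⁾(t)‖ ≤ Γ` (`k ≤ m`) and `‖ξ⁽ᵏ⁾(t)‖ ≤ Γ` (`1 ≤ k ≤ m`), and every point `x` of the
slab `{x⁰ = t}` with `‖x̲ − ξ(t)‖ ≥ max 1 (2|a|)`,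
`‖Dᵐ [y ↦ boostedKerrBilin (Λ (y⁰)) (y⁰, ξ(y⁰)) M a y − η](x)‖ ≤ |M| C / ‖x̲ − ξ(t)‖`.
Kerr–Schild 1965, §2–§3, in the modulated form needed by the crux (the bound is uniform in the
motion given `Γ`; no convergence of `Λ`, `ξ̇` is assumed). [cite: KerrSchild1965, §3] -/
theorem exists_norm_iteratedFDeriv_ansatzSummand_le' (m : ℕ) {Γ : ℝ} (hΓ : 1 ≤ Γ) :
    ∃ C : ℝ, 0 ≤ C ∧ ∀ (M a : ℝ) (Λ : ℝ → lorentzGroup) (ξ : ℝ → E3) (t : ℝ) (x : E4),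
      ContDiff ℝ m (fun s ↦ (((Λ s : E4 ≃L[ℝ] E4).symm : E4 →L[ℝ] E4))) →
      ContDiff ℝ m ξ →
      (∀ k ≤ m, ‖iteratedDeriv k (fun s ↦ (((Λ s : E4 ≃L[ℝ] E4).symm : E4 →L[ℝ] E4))) t‖ ≤ Γ) →
      (∀ k, 1 ≤ k → k ≤ m → ‖iteratedDeriv k ξ t‖ ≤ Γ) →
      x 0 = t → max 1 (2 * |a|) ≤ ‖E4.spatial x - ξ t‖ →
      ‖iteratedFDeriv ℝ m (fun y : E4 ↦ boostedKerrBilin (Λ (y 0)) (E4.ofTimeSpace (y 0) (ξ (y 0)))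
        M a y - Minkowski.bilin) x‖ ≤ |M| * C / ‖E4.spatial x - ξ t‖ := by
  have hΓ1 : 1 ≤ Γ + 1 := by linarith
  obtain ⟨C, hC0, hC⟩ := exists_norm_iteratedFDeriv_ksPert_frame_le' m hΓ1
  refine ⟨C, hC0, fun M a Λ ξ t x hΛ hξ hΛb hξb hx hd ↦ ?_⟩
  have hcc : ContDiff ℝ m (fun s ↦ E4.ofTimeSpace s (ξ s)) := by
    have hsplit : (fun s ↦ E4.ofTimeSpace s (ξ s)) =
        fun s : ℝ ↦ s • E4.basisVector 0 + E4.spaceEmbed (ξ s) :=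
      funext fun s ↦ E4.ofTimeSpace_eq_smul_add' s (ξ s)
    rw [hsplit]
    exact (contDiff_id.smul contDiff_const).add (E4.spaceEmbed.contDiff.comp hξ)
  obtain ⟨h0, hn⟩ := sub_ofTimeSpace_apply_zero hx (ξ t)
  have h1 : ∀ k ≤ m, ‖iteratedDeriv k (fun s ↦ (((Λ s : E4 ≃L[ℝ] E4).symm : E4 →L[ℝ] E4)))
      (x 0)‖ ≤ Γ + 1 := fun k hk ↦ by
    rw [hx]
    exact (hΛb k hk).trans (by linarith)
  have h2 : ∀ k, 1 ≤ k → k ≤ m →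
      ‖iteratedDeriv k (fun s ↦ E4.ofTimeSpace s (ξ s)) (x 0)‖ ≤ Γ + 1 := fun k hk1 hk ↦ by
    rw [hx]
    exact (norm_iteratedDeriv_centre_le hξ t hk1 (by exact_mod_cast hk)).trans
      (by linarith [hξb k hk1 hk])
  have h3 : ‖x - E4.ofTimeSpace (x 0) (ξ (x 0))‖ ≤ ‖E4.spatial x - ξ t‖ := by
    rw [hx, hn]
  have h4 : ‖E4.spatial x - ξ t‖ ≤ E4.spatialNorm ((((Λ (x 0) : E4 ≃L[ℝ] E4).symm : E4 →L[ℝ] E4))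
      (x - E4.ofTimeSpace (x 0) (ξ (x 0)))) := by
    rw [hx]
    have h5 := norm_le_spatialNorm_lorentz_apply (Λ t)⁻¹ h0
    rw [coe_lorentz_inv, hn] at h5
    exact h5
  have key := hC M a (fun s ↦ (((Λ s : E4 ≃L[ℝ] E4).symm : E4 →L[ℝ] E4)))
    (fun s ↦ E4.ofTimeSpace s (ξ s)) x ‖E4.spatial x - ξ t‖ hΛ hcc h1 h2 hd h3 h4
  rw [boostedKerrBilin_sub_eq_bilinearComp]
  exact key

-- operator-norm instance paths on form-valued multilinear maps are slow to unify
set_option synthInstance.maxHeartbeats 200000 in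
/-- Registered sub-goal form (stub `exists_norm_iteratedFDeriv_ansatzSummand_le` of the crux item) of
`exists_norm_iteratedFDeriv_ansatzSummand_le'`: `Cᵐ` decay `|M| C / ‖x̲ − ξ(t)‖` of one summand of
the modulated ansatz on a lab slab. Kerr–Schild 1965, §3. [cite: KerrSchild1965, §3] -/
theorem exists_norm_iteratedFDeriv_ansatzSummand_le : open Literature.Geometry.Lorentzian in ∀ (m : ℕ) {Γ : ℝ}, 1 ≤ Γ → ∃ C : ℝ, 0 ≤ C ∧ ∀ (M a : ℝ) (Λ : ℝ → lorentzGroup) (ξ : ℝ → E3) (t : ℝ) (x : E4), ContDiff ℝ m (fun s ↦ (((Λ s : E4 ≃L[ℝ] E4).symm : E4 →L[ℝ] E4))) → ContDiff ℝ m ξ → (∀ k ≤ m, ‖iteratedDeriv k (fun s ↦ (((Λ s : E4 ≃L[ℝ] E4).symm : E4 →L[ℝ] E4))) t‖ ≤ Γ) → (∀ k, 1 ≤ k → k ≤ m → ‖iteratedDeriv k ξ t‖ ≤ Γ) → x 0 = t → max 1 (2 * |a|) ≤ ‖E4.spatial x - ξ t‖ → ‖iteratedFDeriv ℝ m (fun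 y : E4 ↦ boostedKerrBilin (Λ (y 0)) (E4.ofTimeSpace (y 0) (ξ (y 0))) M a y - Minkowski.bilin) x‖ ≤ |M| * C / ‖E4.spatial x - ξ t‖ :=
  exists_norm_iteratedFDeriv_ansatzSummand_le'

end Summit.FinalStateConjecture.FinalStateConjecture.Theorems

end
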